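import Summits.Schanuel.Schanuel.Theorems.ZilberEacSuperellipticConstFibre
import Summits.Schanuel.Schanuel.Theorems.ZilberEacBranchTauCoefficientGrowth
import HarnessLib

/-!
# Arbitrary base branches, XXX: constant fibres over the SUPERELLIPTIC curves `x₁^k = P(x₀)`
# INSIDE the residue class are dense OFF ONE CIRCLE `|θ| = exp(−Re p_{M−1}/M)`

HONEST FRAMING.  Cell `pub-schanuel` (Zilber's Exponential-Algebraic Closedness, case ladder;
host summit Schanuel), seat 2, gen 29.  File XXII decided the constant fibres `y₀ = θ` over
`C : x₁^k = P(x₀)` (`P` monic of degree `M` with a simple root) OFF the residue class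
`k ∣ 2M ∧ 2M/k ≡ 2 (mod 4)`, where the top phase coefficient `Π_M = z^M` is purely imaginary for
every `k`-th root `z` of `2πi`.  Inside the class the branch at infinity is `x₀ = s^{-k}`,
`x₁ = U₀(s)^{1/k}s^{-M}` with `U₀(s) = s^{kM}P(s^{-k}) = 1 + p_{M−1}s^k + O(s^{2k})`, so the Taylor
polynomial of `Φ = U₀^{1/k}` to order `k` is `1 + (p_{M−1}/k)s^k` (**`tendsto_monic_polar_sub_one_div_pow`**,
**`tendsto_kthRoot_comp_sub_one_div_pow`**), and by file XXIX the `τ`-carrying coefficient is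
`Π_{M−k} = z^{M−k}(p_{M−1} + M·log θ)/k` with `z^{M−k} = z^M/(2πi)` REAL and nonzero in the
residue class (**`exists_real_direction_of_residue`**).  Hence (`M > k`)
**`unprojectedDense_superelliptic_constFibre_residue`**: dense whenever
`M·log|θ| + Re p_{M−1} ≠ 0`, i.e. for all fibre values `θ` OFF ONE CIRCLE; with file XXII,
**`unprojectedDensityQuestion_superelliptic_constFibre_offCircle`** (`k ≥ 2`, `M > k`, every
residue): `{x₁^k − P(x₀) = 0, y₀ = θ}` is in Mantova–Masser's case AND dense for every `θ` off that
circle — in particular (**`unprojectedDensityQuestion_hyperelliptic_constFibre_offCircle`**) for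
EVERY hyperelliptic curve `x₁² = P(x₀)`, `deg P ≥ 3` (the even degrees `≡ 2 (mod 4)` were open).
This is the first decided family where the answer is read off the MODULUS of the fibre value; on
the circle itself `Re Π` may be constant on the principal sheet.  (For `k ≥ 3` the non-principal
sheets `x₁ = ζ·U₀^{1/k}s^{-M}`, `ζ ∈ μ_k ∖ ℝ`, remove the circle condition altogether — file XXXIV;
the lasting content of the circle is `k = 2`, where both sheets `±1` are real.)  Decided instances of an OPEN question (Mantova–Masser, PLMS 2024 §1 p. 5);
EC(3,2) OPEN; NOT Schanuel's conjecture (neither used nor implied); EAC ⇏ SC.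
-/

noncomputable section

open Filter Topology Set Complex MvPolynomial
open Literature.NumberTheory.Transcendental Literature.ModelTheory.Zilber
open Literature.ModelTheory.ExponentialFields

set_option linter.dupNamespace false

namespace Summit.Schanuel.Schanuel.Theorems

/-! ## Part A. Taylor data of the branch `x₁ = U₀(s)^{1/k} s^{-M}` -/

/-- **The reversed polynomial to second order**: for `P` monic of degree `M ≥ 1` and `n ≥ 1`,
`(P(s^{-n})s^{nM} − 1)/s^n → p_{M−1}` as `s → 0`. [folklore] -/
theorem tendsto_monic_polar_sub_one_div_pow {P : Polynomial ℂ} (hP : P.Monic) {M : ℕ}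
    (hPM : P.natDegree = M) (hM : 1 ≤ M) {n : ℕ} (hn : 1 ≤ n) :
    Tendsto (fun s : ℂ => (P.eval (s⁻¹ ^ n) * s ^ (n * M) - 1) / s ^ n) (𝓝[≠] (0 : ℂ))
      (𝓝 (P.coeff (M - 1))) := by
  classical
  have hlim : Tendsto (fun s : ℂ => ∑ i ∈ Finset.range M, P.coeff i * s ^ (n * (M - 1 - i)))
      (𝓝[≠] (0 : ℂ)) (𝓝 (∑ i ∈ Finset.range M, P.coeff i * (0 : ℂ) ^ (n * (M - 1 - i)))) :=
    tendsto_finsetSum _ fun i _ =>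
      tendsto_const_nhds.mul (((continuous_pow _).tendsto (0 : ℂ)).mono_left nhdsWithin_le_nhds)
  have hval : ∑ i ∈ Finset.range M, P.coeff i * (0 : ℂ) ^ (n * (M - 1 - i)) = P.coeff (M - 1) := by
    rw [Finset.sum_eq_single_of_mem (M - 1) (Finset.mem_range.2 (by omega))]
    · rw [Nat.sub_self, mul_zero, pow_zero, mul_one]
    · intro i hi hne
      have hi' : i < M := Finset.mem_range.1 hi
      have hpos : n * (M - 1 - i) ≠ 0 := mul_ne_zero (by omega) (by omega)
      rw [zero_pow hpos, mul_zero]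
  rw [hval] at hlim
  refine hlim.congr' ?_
  filter_upwards [self_mem_nhdsWithin] with s (hs : s ≠ 0)
  have hsn : s ^ n ≠ 0 := pow_ne_zero _ hs
  have hlast : (s⁻¹ ^ n) ^ M * s ^ (n * M) = 1 := by
    rw [← pow_mul, inv_pow, inv_mul_cancel₀ (pow_ne_zero _ hs)]
  rw [eq_div_iff hsn, Polynomial.eval_eq_sum_range' (show P.natDegree < M + 1 by omega),
    Finset.sum_range_succ, ← hPM, hP.coeff_natDegree, hPM, one_mul, add_mul, hlast,
    add_sub_cancel_right, Finset.sum_mul, Finset.sum_mul]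
  refine Finset.sum_congr rfl fun i hi => ?_
  have hi' : i < M := Finset.mem_range.1 hi
  obtain ⟨d, hd⟩ : ∃ d, M = i + 1 + d := ⟨M - 1 - i, by omega⟩
  have e1 : n * (M - 1 - i) + n = n * (d + 1) := by
    rw [hd, show i + 1 + d - 1 - i = d from by omega]; ring
  have e2 : n * M = n * i + n * (d + 1) := by rw [hd]; ring
  rw [mul_assoc, ← pow_add, e1, e2, pow_add, ← pow_mul, inv_pow]
  field_simp

/-- **Composition with the `k`-th root to order `n`**: if `q(v)^k = 1 + v` near `0`, `q(0) = 1`,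
`q` analytic, `v(s) → 0` and `v(s)/s^n → a` along `s → 0` (`s ≠ 0`), then
`(q(v(s)) − 1)/s^n → a/k` (since `(q − 1)(1 + q + ⋯ + q^{k−1}) = v`). [folklore] -/
theorem tendsto_kthRoot_comp_sub_one_div_pow {q : ℂ → ℂ} (hqan : AnalyticAt ℂ q 0) (hq0 : q 0 = 1)
    {k : ℕ} (hk : 1 ≤ k) (hqk : ∀ᶠ v in 𝓝 (0 : ℂ), q v ^ k = 1 + v) {v : ℂ → ℂ}
    (hv0 : Tendsto v (𝓝[≠] (0 : ℂ)) (𝓝 0)) {n : ℕ} {a : ℂ}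
    (hva : Tendsto (fun s => v s / s ^ n) (𝓝[≠] (0 : ℂ)) (𝓝 a)) :
    Tendsto (fun s => (q (v s) - 1) / s ^ n) (𝓝[≠] (0 : ℂ)) (𝓝 (a / k)) := by
  have hkC : (k : ℂ) ≠ 0 := Nat.cast_ne_zero.2 (by omega)
  set R : ℂ → ℂ := fun w => ∑ i ∈ Finset.range k, q w ^ i with hR
  have hRt : Tendsto R (𝓝 (0 : ℂ)) (𝓝 (k : ℂ)) := by
    have hq1 : Tendsto q (𝓝 (0 : ℂ)) (𝓝 1) := by
      have h := hqan.continuousAt.tendsto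
      rwa [hq0] at h
    have h := tendsto_finsetSum (Finset.range k) (fun i _ => hq1.pow i)
    simp only [one_pow, Finset.sum_const, Finset.card_range, nsmul_eq_mul, mul_one] at h
    exact h
  have hRv : Tendsto (fun s => R (v s)) (𝓝[≠] (0 : ℂ)) (𝓝 (k : ℂ)) := hRt.comp hv0
  have hRne : ∀ᶠ s in 𝓝[≠] (0 : ℂ), R (v s) ≠ 0 := hRv.eventually_ne hkC
  have hid : ∀ᶠ s in 𝓝[≠] (0 : ℂ), (q (v s) - 1) * R (v s) = v s := by
    filter_upwards [hv0.eventually hqk] with s hs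
    have hgeom : R (v s) * (q (v s) - 1) = q (v s) ^ k - 1 := geom_sum_mul _ _
    rw [mul_comm, hgeom, hs]
    ring
  have hmain : Tendsto (fun s => v s / s ^ n / R (v s)) (𝓝[≠] (0 : ℂ)) (𝓝 (a / k)) :=
    hva.div hRv hkC
  refine hmain.congr' ?_
  filter_upwards [hid, hRne, self_mem_nhdsWithin] with s hs hRs (hs0 : s ≠ 0)
  have hsn : s ^ n ≠ 0 := pow_ne_zero _ hs0
  rw [div_div, div_eq_div_iff (mul_ne_zero hsn hRs) hsn]
  linear_combination (-(s ^ n)) * hs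

/-! ## Part B. In the residue class `z^{M−k}` is real -/

/-- **A real direction in the residue class**: if `k ∣ 2M` and `2M/k ≡ 2 (mod 4)` then for any
`k`-th root `z` of `2πi`, `z^{M−k}` is REAL and nonzero (`(z^{M−k})² = (2πi)^{(2M−2k)/k} = (2π)^{4e}
> 0`). [folklore] -/
theorem exists_real_direction_of_residue {k M : ℕ} (hk : 1 ≤ k)
    (hres : k ∣ 2 * M ∧ (2 * M / k) % 4 = 2) :
    ∃ z : ℂ, z ^ k = 2 * Real.pi * I ∧ (z ^ (M - k)).im = 0 ∧ (z ^ (M - k)).re ≠ 0 := by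
  obtain ⟨z, hz⟩ := IsAlgClosed.exists_pow_nat_eq (2 * Real.pi * I : ℂ) (by omega : 0 < k)
  refine ⟨z, hz, ?_⟩
  obtain ⟨hdvd, hmod⟩ := hres
  obtain ⟨e, he⟩ : ∃ e, 2 * M / k = 4 * e + 2 := ⟨2 * M / k / 4, by omega⟩
  have h2M : 2 * M = k * (4 * e + 2) := by rw [← he]; exact (Nat.mul_div_cancel' hdvd).symm
  have h2M' : 2 * M = 4 * (k * e) + 2 * k := by rw [h2M]; ring
  have hexp : (M - k) * 2 = k * (4 * e) := by
    rw [show k * (4 * e) = 4 * (k * e) from by ring]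
    generalize k * e = t at h2M' ⊢
    omega
  set w : ℂ := z ^ (M - k) with hw
  have h4 : (2 * (Real.pi : ℂ) * I) ^ 4 = (2 * (Real.pi : ℂ)) ^ 4 := by
    rw [mul_pow, Complex.I_pow_four, mul_one]
  have hw2 : w ^ 2 = (((2 * Real.pi) ^ (4 * e) : ℝ) : ℂ) := by
    rw [hw, ← pow_mul, hexp, pow_mul, hz, pow_mul, h4, ← pow_mul]
    norm_cast
  have hr : (0 : ℝ) < (2 * Real.pi) ^ (4 * e) := by positivity
  have hre2 : w.re * w.re - w.im * w.im = (2 * Real.pi) ^ (4 * e) := by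
    have h := congrArg Complex.re hw2
    rw [sq, Complex.mul_re, Complex.ofReal_re] at h
    exact h
  have him2 : w.re * w.im + w.im * w.re = 0 := by
    have h := congrArg Complex.im hw2
    rw [sq, Complex.mul_im, Complex.ofReal_im] at h
    exact h
  have hre0 : w.re ≠ 0 := by
    intro h0
    rw [h0] at hre2
    nlinarith [sq_nonneg w.im]
  refine ⟨?_, hre0⟩
  have h2 : 2 * (w.re * w.im) = 0 := by linarith
  rcases mul_eq_zero.1 h2 with h | h
  · norm_num at h
  · rcases mul_eq_zero.1 h with h' | h'
    · exact absurd h' hre0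
    · exact h'

/-! ## Part C. Density in the residue class off one circle -/

section Superelliptic

variable (P : Polynomial ℂ)

/-- **Constant fibres over `x₁^k = P(x₀)` in the residue class are dense off one circle**
(`1 ≤ k < M = deg P`, `P` monic with a simple root, `k ∣ 2M ∧ 2M/k ≡ 2 (mod 4)`, `θ ≠ 0` with
`M·log|θ| + Re p_{M−1} ≠ 0`): the `τ`-carrying phase coefficient on the branch at infinity is
`Π_{M−k} = z^{M−k}(p_{M−1} + M log θ)/k` with `z^{M−k}` real (files XXVIII, XXIX).
[cite: MantovaMasser2023, §1 Further remarks, p. 5 (the question, open in general)] (new) -/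
theorem unprojectedDense_superelliptic_constFibre_residue {k : ℕ} (hk : 1 ≤ k) (hP : P.Monic)
    (hkM : k < P.natDegree) {r : ℂ} (hr : P.IsRoot r) (hr1 : P.derivative.eval r ≠ 0)
    (hres : k ∣ 2 * P.natDegree ∧ (2 * P.natDegree / k) % 4 = 2) {θ : ℂ} (hθ : θ ≠ 0)
    (hθP : (P.natDegree : ℝ) * Real.log ‖θ‖ + (P.coeff (P.natDegree - 1)).re ≠ 0) :
    UnprojectedDense {w : Fin 2 ⊕ Fin 2 → ℂ |
      MvPolynomial.eval ![w (Sum.inl 0), w (Sum.inl 1)]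
          (X 1 ^ k - Polynomial.aeval (X 0 : MvPolynomial (Fin 2) ℂ) P) = 0 ∧
      w (Sum.inr 0) = MvPolynomial.eval ![w (Sum.inl 0), w (Sum.inl 1)]
        (MvPolynomial.C θ : MvPolynomial (Fin 2) ℂ)} := by
  set M := P.natDegree with hMdef
  have hk0 : k ≠ 0 := by omega
  have hkC : (k : ℂ) ≠ 0 := Nat.cast_ne_zero.2 hk0
  have hS := isIrreducibleClosed_curveGraphFibre (MvPolynomial.C θ : MvPolynomial (Fin 2) ℂ)
    (irreducible_superellipticMv P hk hr hr1)
  have hdim := zariskiDim_curveGraphFibre (MvPolynomial.C θ : MvPolynomial (Fin 2) ℂ)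
    (irreducible_superellipticMv P hk hr hr1)
  obtain ⟨q, hqan, hq0, hqk⟩ := kthRoot_branch_facts hk
  obtain ⟨U₀, hUan, hU0, hUeval⟩ :=
    exists_polarForm_eval P (U := fun _ : ℂ => (1 : ℂ)) analyticAt_const hk
  rw [one_pow, mul_one, hP.leadingCoeff] at hU0
  -- `x₀ = s^{-k}`, `x₁ = q(U₀(s) − 1) s^{-M}`, `y₀ = θ`
  have hvan : AnalyticAt ℂ (fun s => U₀ s - 1) 0 := hUan.sub analyticAt_const
  have hv0 : U₀ 0 - 1 = 0 := by rw [hU0, sub_self]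
  set Φ : ℂ → ℂ := fun s => q (U₀ s - 1) with hΦ
  have hΦan : AnalyticAt ℂ Φ 0 := hqan.comp_of_eq hvan hv0
  have hΦ0 : Φ 0 = 1 := by
    simp only [hΦ, hU0, sub_self]
    exact hq0
  have hψan : AnalyticAt ℂ (fun _ : ℂ => θ) 0 := analyticAt_const
  have hqk' : ∀ᶠ s in 𝓝 (0 : ℂ), q (U₀ s - 1) ^ k = 1 + (U₀ s - 1) := by
    have h := hvan.continuousAt.tendsto
    rw [hv0] at h
    exact h.eventually hqk
  have hgerm : ∀ᶠ s in 𝓝[≠] (0 : ℂ),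
      (Sum.elim ![(s ^ k)⁻¹, Φ s * (s ^ M)⁻¹]
          ![(fun _ : ℂ => θ) s, Complex.exp (Φ s * (s ^ M)⁻¹)] : Fin 2 ⊕ Fin 2 → ℂ) ∈
        {w : Fin 2 ⊕ Fin 2 → ℂ |
          MvPolynomial.eval ![w (Sum.inl 0), w (Sum.inl 1)]
              (X 1 ^ k - Polynomial.aeval (X 0 : MvPolynomial (Fin 2) ℂ) P) = 0 ∧
          w (Sum.inr 0) = MvPolynomial.eval ![w (Sum.inl 0), w (Sum.inl 1)]
            (MvPolynomial.C θ : MvPolynomial (Fin 2) ℂ)} := by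
    filter_upwards [self_mem_nhdsWithin, nhdsWithin_le_nhds hqk'] with s (hs : s ≠ 0) hqs
    refine ⟨?_, ?_⟩
    · simp only [Sum.elim_inl, Matrix.cons_val_zero, Matrix.cons_val_one]
      rw [eval_superellipticMv]
      simp only [Matrix.cons_val_zero, Matrix.cons_val_one, hΦ]
      have hU := hUeval s hs
      simp only [one_mul, inv_pow] at hU
      rw [mul_pow, hqs, hU, inv_pow, ← pow_mul, Nat.mul_comm M k,
        show (1 : ℂ) + (U₀ s - 1) = U₀ s by ring, sub_self]
    · simp only [Sum.elim_inr, Matrix.cons_val_zero, MvPolynomial.eval_C]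
  -- TAYLOR DATA: `Φ(s) = 1 + (p_{M−1}/k)s^k + o(s^k)`
  have hvt0 : Tendsto (fun s => U₀ s - 1) (𝓝[≠] (0 : ℂ)) (𝓝 0) := by
    have h := hvan.continuousAt.tendsto
    rw [hv0] at h
    exact h.mono_left nhdsWithin_le_nhds
  have hvt : Tendsto (fun s => (U₀ s - 1) / s ^ k) (𝓝[≠] (0 : ℂ)) (𝓝 (P.coeff (M - 1))) := by
    refine (tendsto_monic_polar_sub_one_div_pow hP hMdef.symm (by omega) hk).congr' ?_
    filter_upwards [self_mem_nhdsWithin] with s (hs : s ≠ 0)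
    have hU := hUeval s hs
    simp only [one_mul, inv_pow] at hU
    rw [inv_pow, hU, ← hMdef, mul_assoc, inv_mul_cancel₀ (pow_ne_zero _ hs), mul_one]
  have hΦt : Tendsto (fun s => (Φ s - 1) / s ^ k) (𝓝[≠] (0 : ℂ)) (𝓝 (P.coeff (M - 1) / k)) :=
    tendsto_kthRoot_comp_sub_one_div_pow hqan hq0 hk hqk hvt0 hvt
  set PΦ : Polynomial ℂ := Polynomial.C 1 + Polynomial.C (P.coeff (M - 1) / k) * Polynomial.X ^ k
    with hPΦ
  have hPΦdeg : PΦ.natDegree ≤ k := by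
    refine Polynomial.natDegree_add_le_of_degree_le ?_ (Polynomial.natDegree_C_mul_X_pow_le _ _)
    rw [Polynomial.natDegree_C]
    exact Nat.zero_le _
  have hPΦk : PΦ.coeff k = P.coeff (M - 1) / k := by
    rw [hPΦ, Polynomial.coeff_add, Polynomial.coeff_C, if_neg hk0, Polynomial.coeff_C_mul_X_pow,
      if_pos rfl, zero_add]
  have hΦT : Tendsto (fun s => (Φ s - PΦ.eval s) / s ^ k) (𝓝[≠] (0 : ℂ)) (𝓝 0) := by
    have h := hΦt.sub_const (P.coeff (M - 1) / k)
    rw [sub_self] at h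
    refine h.congr' ?_
    filter_upwards [self_mem_nhdsWithin] with s (hs : s ≠ 0)
    have hsk : s ^ k ≠ 0 := pow_ne_zero _ hs
    rw [hPΦ, Polynomial.eval_add, Polynomial.eval_C, Polynomial.eval_mul, Polynomial.eval_C,
      Polynomial.eval_pow, Polynomial.eval_X]
    field_simp
    ring
  -- DIRECTION: `z^{M−k}` real, `Re Π_{M−k} = Re(z^{M−k})·(Re p_{M−1} + M log|θ|)/k ≠ 0`
  obtain ⟨z, hz, him, hre⟩ := exists_real_direction_of_residue (M := M) hk hres
  refine unprojectedDense_branch_growth_of_tau_coeff hS (le_of_eq hdim) hk hkM hψan hθ rfl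
    hΦan hPΦdeg hΦT ⟨z, hz, ?_⟩ hgerm
  have hquant : z ^ (M - k) * (PΦ.coeff k + (M : ℂ) / k * Complex.log θ * Φ 0) =
      z ^ (M - k) * ((P.coeff (M - 1) + ((M : ℝ) : ℂ) * Complex.log θ) / k) := by
    rw [hPΦk, hΦ0, Complex.ofReal_natCast]
    field_simp
  rw [hquant, Complex.mul_re, him, zero_mul, sub_zero, Complex.div_natCast_re, Complex.add_re,
    Complex.re_ofReal_mul, Complex.log_re]
  refine mul_ne_zero hre (div_ne_zero ?_ (Nat.cast_ne_zero.2 hk0))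
  rw [add_comm]
  exact hθP

/-- **Mantova–Masser's question for constant fibres over the superelliptic curves `x₁^k = P(x₀)`,
every residue, off one circle: case ∧ dense** (`2 ≤ k < M = deg P`; `P` monic with a simple
root; `θ ≠ 0` with `M·log|θ| + Re p_{M−1} ≠ 0`).  Off the residue class the circle condition is
not needed (file XXII); inside it, it is what the `τ`-coefficient gives.
[cite: MantovaMasser2023, §1 Further remarks, p. 5 (the question, open in general)] (new) -/
theorem unprojectedDensityQuestion_superelliptic_constFibre_offCircle {k : ℕ} (hk : 2 ≤ k)
    (hP : P.Monic) (hkM : k < P.natDegree) {r : ℂ} (hr : P.IsRoot r)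
    (hr1 : P.derivative.eval r ≠ 0) {θ : ℂ} (hθ : θ ≠ 0)
    (hθP : (P.natDegree : ℝ) * Real.log ‖θ‖ + (P.coeff (P.natDegree - 1)).re ≠ 0) :
    MMCaseDimPiOneFree {w : Fin 2 ⊕ Fin 2 → ℂ |
        MvPolynomial.eval ![w (Sum.inl 0), w (Sum.inl 1)]
            (X 1 ^ k - Polynomial.aeval (X 0 : MvPolynomial (Fin 2) ℂ) P) = 0 ∧
        w (Sum.inr 0) = MvPolynomial.eval ![w (Sum.inl 0), w (Sum.inl 1)]
          (MvPolynomial.C θ : MvPolynomial (Fin 2) ℂ)} ∧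
      UnprojectedDense {w : Fin 2 ⊕ Fin 2 → ℂ |
        MvPolynomial.eval ![w (Sum.inl 0), w (Sum.inl 1)]
            (X 1 ^ k - Polynomial.aeval (X 0 : MvPolynomial (Fin 2) ℂ) P) = 0 ∧
        w (Sum.inr 0) = MvPolynomial.eval ![w (Sum.inl 0), w (Sum.inl 1)]
          (MvPolynomial.C θ : MvPolynomial (Fin 2) ℂ)} := by
  refine ⟨mmCase_superelliptic_constFibre P hk hr hr1 hθ, ?_⟩
  by_cases hres : k ∣ 2 * P.natDegree ∧ (2 * P.natDegree / k) % 4 = 2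
  · exact unprojectedDense_superelliptic_constFibre_residue P (by omega) hP hkM hr hr1 hres hθ hθP
  · exact unprojectedDense_superelliptic_constFibre P (by omega) hP (by omega) hr hr1 hres hθ

/-- **Plain coordinates**: `{x₁^k − P(x₀) = 0, y₀ = θ}` is in the case AND dense (hypotheses as
above). [cite: MantovaMasser2023, §1 Further remarks, p. 5 (the question, open in general)] (new) -/
theorem unprojectedDensityQuestion_superelliptic_constFibre_offCircle' {k : ℕ} (hk : 2 ≤ k)
    (hP : P.Monic) (hkM : k < P.natDegree) {r : ℂ} (hr : P.IsRoot r)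
    (hr1 : P.derivative.eval r ≠ 0) {θ : ℂ} (hθ : θ ≠ 0)
    (hθP : (P.natDegree : ℝ) * Real.log ‖θ‖ + (P.coeff (P.natDegree - 1)).re ≠ 0) :
    MMCaseDimPiOneFree {w : Fin 2 ⊕ Fin 2 → ℂ |
        w (Sum.inl 1) ^ k - P.eval (w (Sum.inl 0)) = 0 ∧ w (Sum.inr 0) = θ} ∧
      UnprojectedDense {w : Fin 2 ⊕ Fin 2 → ℂ |
        w (Sum.inl 1) ^ k - P.eval (w (Sum.inl 0)) = 0 ∧ w (Sum.inr 0) = θ} := by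
  have e : {w : Fin 2 ⊕ Fin 2 → ℂ |
        MvPolynomial.eval ![w (Sum.inl 0), w (Sum.inl 1)]
            (X 1 ^ k - Polynomial.aeval (X 0 : MvPolynomial (Fin 2) ℂ) P) = 0 ∧
        w (Sum.inr 0) = MvPolynomial.eval ![w (Sum.inl 0), w (Sum.inl 1)]
          (MvPolynomial.C θ : MvPolynomial (Fin 2) ℂ)} =
      {w : Fin 2 ⊕ Fin 2 → ℂ |
        w (Sum.inl 1) ^ k - P.eval (w (Sum.inl 0)) = 0 ∧ w (Sum.inr 0) = θ} := by
    ext w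
    simp only [Set.mem_setOf_eq, eval_superellipticMv, MvPolynomial.eval_C, Matrix.cons_val_zero,
      Matrix.cons_val_one]
  have h := unprojectedDensityQuestion_superelliptic_constFibre_offCircle P hk hP hkM hr hr1 hθ hθP
  rw [e] at h
  exact h

/-- **EVERY hyperelliptic curve of degree `≥ 3`**: for `P` monic of degree `M ≥ 3` with a simple
root and every `θ ≠ 0` off the circle `M·log|θ| + Re p_{M−1} = 0`, `{x₁² − P(x₀) = 0, y₀ = θ}` is
in Mantova–Masser's case AND dense (for `M ≢ 2 (mod 4)` and all `θ ≠ 0` this was file XXII; the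
degrees `M ≡ 2 (mod 4)` — genus `2, 4, 6, …` — are new).
[cite: MantovaMasser2023, §1 Further remarks, p. 5 (the question, open in general)] (new) -/
theorem unprojectedDensityQuestion_hyperelliptic_constFibre_offCircle (hP : P.Monic)
    (h3 : 3 ≤ P.natDegree) {r : ℂ} (hr : P.IsRoot r) (hr1 : P.derivative.eval r ≠ 0) {θ : ℂ}
    (hθ : θ ≠ 0)
    (hθP : (P.natDegree : ℝ) * Real.log ‖θ‖ + (P.coeff (P.natDegree - 1)).re ≠ 0) :
    MMCaseDimPiOneFree {w : Fin 2 ⊕ Fin 2 → ℂ |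
        w (Sum.inl 1) ^ 2 - P.eval (w (Sum.inl 0)) = 0 ∧ w (Sum.inr 0) = θ} ∧
      UnprojectedDense {w : Fin 2 ⊕ Fin 2 → ℂ |
        w (Sum.inl 1) ^ 2 - P.eval (w (Sum.inl 0)) = 0 ∧ w (Sum.inr 0) = θ} :=
  unprojectedDensityQuestion_superelliptic_constFibre_offCircle' P (le_refl 2) hP (by omega) hr hr1
    hθ hθP

/-- **The power curves `x₁^k = x₀^M + 1` for ALL `2 ≤ k < M`, off the unit circle**: for every
`θ` with `|θ| ∉ {0, 1}`, `{x₁^k − x₀^M − 1 = 0, y₀ = θ}` is in Mantova–Masser's case AND dense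
(file XX needed `¬(k ∣ 2M ∧ 2M/k ≡ 2 mod 4)`; here `p_{M−1} = 0`, so the excluded circle is
`|θ| = 1`; e.g. the genus-two curve `x₁² = x₀⁶ + 1`). [cite: MantovaMasser2023, §1 Further remarks, p. 5 (the question, open in general)]
(new) -/
theorem unprojectedDensityQuestion_powerCurve_constFibre_offUnitCircle {k M : ℕ} (hk : 2 ≤ k)
    (hkM : k < M) {θ : ℂ} (hθ : θ ≠ 0) (hθ1 : ‖θ‖ ≠ 1) :
    MMCaseDimPiOneFree {w : Fin 2 ⊕ Fin 2 → ℂ |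
        w (Sum.inl 1) ^ k - w (Sum.inl 0) ^ M - 1 = 0 ∧ w (Sum.inr 0) = θ} ∧
      UnprojectedDense {w : Fin 2 ⊕ Fin 2 → ℂ |
        w (Sum.inl 1) ^ k - w (Sum.inl 0) ^ M - 1 = 0 ∧ w (Sum.inr 0) = θ} := by
  have hM0 : M ≠ 0 := by omega
  have hmonic : (Polynomial.X ^ M + 1 : Polynomial ℂ).Monic := by
    simpa using Polynomial.monic_X_pow_add_C (1 : ℂ) hM0
  have hdeg : (Polynomial.X ^ M + 1 : Polynomial ℂ).natDegree = M := by
    simpa using Polynomial.natDegree_X_pow_add_C (n := M) (r := (1 : ℂ))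
  obtain ⟨ζ, hζ⟩ := IsAlgClosed.exists_pow_nat_eq (-1 : ℂ) (by omega : 0 < M)
  have hζ0 : ζ ≠ 0 := by
    rintro rfl
    rw [zero_pow hM0] at hζ
    norm_num at hζ
  have hroot : (Polynomial.X ^ M + 1 : Polynomial ℂ).IsRoot ζ := by
    simp [Polynomial.IsRoot, hζ]
  have hder : (Polynomial.derivative (Polynomial.X ^ M + 1 : Polynomial ℂ)).eval ζ ≠ 0 := by
    rw [Polynomial.derivative_add, Polynomial.derivative_one, Polynomial.derivative_X_pow, add_zero,
      Polynomial.eval_mul, Polynomial.eval_C, Polynomial.eval_pow, Polynomial.eval_X]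
    exact mul_ne_zero (Nat.cast_ne_zero.2 hM0) (pow_ne_zero _ hζ0)
  have hcoeff : ((Polynomial.X ^ M + 1 : Polynomial ℂ).coeff (M - 1)).re = 0 := by
    rw [Polynomial.coeff_add, Polynomial.coeff_X_pow, if_neg (by omega), Polynomial.coeff_one,
      if_neg (by omega), add_zero, Complex.zero_re]
  have hθP : ((Polynomial.X ^ M + 1 : Polynomial ℂ).natDegree : ℝ) * Real.log ‖θ‖ +
      ((Polynomial.X ^ M + 1 : Polynomial ℂ).coeff
        ((Polynomial.X ^ M + 1 : Polynomial ℂ).natDegree - 1)).re ≠ 0 := by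
    rw [hdeg, hcoeff, add_zero]
    exact mul_ne_zero (Nat.cast_ne_zero.2 hM0)
      (Real.log_ne_zero_of_pos_of_ne_one (norm_pos_iff.2 hθ) hθ1)
  have e : {w : Fin 2 ⊕ Fin 2 → ℂ |
        w (Sum.inl 1) ^ k - (Polynomial.X ^ M + 1 : Polynomial ℂ).eval (w (Sum.inl 0)) = 0 ∧
          w (Sum.inr 0) = θ} =
      {w : Fin 2 ⊕ Fin 2 → ℂ |
        w (Sum.inl 1) ^ k - w (Sum.inl 0) ^ M - 1 = 0 ∧ w (Sum.inr 0) = θ} := by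
    ext w
    simp only [Set.mem_setOf_eq, Polynomial.eval_add, Polynomial.eval_pow, Polynomial.eval_X,
      Polynomial.eval_one, sub_sub]
  have h := unprojectedDensityQuestion_superelliptic_constFibre_offCircle' _ hk hmonic (by omega)
    hroot hder hθ hθP
  rw [e] at h
  exact h

end Superelliptic

end Summit.Schanuel.Schanuel.Theorems

end
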